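import Summits.CriticalPhenomena.CardyFormulaZ2.Theorems.CardyIKTransportCornerLineDescentLine
import Literature.Probability.RandomPlanarGeometry.CaratheodoryHalfPlane
import Literature.Probability.RandomPlanarGeometry.ImageUnivalent

/-!
# The conjugated shrink `T_λ = F ∘ (λ ·) ∘ F⁻¹` (`stub_TameShrink`, crux `CardyIKTransport.CornerLineDescent`)

Support file (`--supports stmt-CriticalPhenomena-10964`, registered sub-goal `stub_TameShrink`) for the line
`symmetric-seed-second-order` of the crux `CardyIKTransport.CornerLineDescent` (lead c4 reshape: tame rectangles +
the crude-Cardy domain approximation `crudeBondCardy_of_tame`).  THE STUB IS A THEOREM (complex-analysis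
bookkeeping, no new mathematics).  Data: a conformal rectangle `R` with uniformizing datum `(φ, x)`, and a plane
homeomorphism `F : ℂ ≃ₜ ℂ` extending the Riemann map `φ ∘ cayley⁻¹ : 𝔻 → R` of the disc (the neighbouring stub
`stub_RiemannMapPlaneExtension`).  For `0 < λ < 1` the CONJUGATED SHRINK `T_λ := F ∘ (λ ·) ∘ F⁻¹` is a plane
homeomorphism with

* (i) `T_λ → id` uniformly on the compact unit neighbourhood `K` of `closure R` as `λ → 1⁻`: `F⁻¹ K` lies in a closed
  disc `|u| ≤ M`, on which `F` is uniformly continuous, and `|λ u - u| = (1 - λ)|u| ≤ (1 - λ) M`;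
* (ii) `R.map T_λ` is TAME: its carrier `T_λ (R) = F (λ 𝔻) = G(𝔻)` for `G w := F (λ w)`, which is holomorphic and
  injective on the larger disc `|w| < 1/λ` (there `λ w ∈ 𝔻`, where `F = φ ∘ cayley⁻¹` is holomorphic; `F` is
  injective);
* (iii) `(T_λ ∘ φ, x)` uniformizes `R.map T_λ` with the SAME real boundary preimages `x` (tree
  `MarkedDomain.IsUniformizing.image_data`): on `R.carrier` one has `F⁻¹ = (φ ∘ cayley⁻¹)⁻¹`, so
  `T_λ = (φ ∘ cayley⁻¹) ∘ (λ ·) ∘ (φ ∘ cayley⁻¹)⁻¹` is holomorphic there, and it is injective and continuous.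

References: route file `Theses/CardyIKTransport.lean` (item 10964); Beffara, *Cardy's formula on the triangular
lattice, the easy way* (2008), §1.2 Def. 3 (transport of uniformizing data); Pommerenke, *Boundary Behaviour of
Conformal Maps* (1992), §1.2.
-/

noncomputable section

namespace Summit.CriticalPhenomena.CardyFormulaZ2.Theorems.CornerLineDescent.SymmetricSeed

open scoped Topology
open Filter Set Metric
open Literature.Probability.RandomPlanarGeometry

/-- If a plane homeomorphism `F` extends a conformal equivalence `ψ : 𝔻 → V`, then `F 𝔻 = V`. [folklore] -/
theorem TameShrink.image_ball_of_eqOn {V : Set ℂ} (F : ℂ ≃ₜ ℂ) (ψ : ConformalEquiv (ball (0:ℂ) 1) V)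
    (hF : EqOn F ψ (ball 0 1)) : F '' ball 0 1 = V :=
  hF.image_eq.trans ψ.bijOn.image_eq

/-- If a plane homeomorphism `F` extends a conformal equivalence `ψ : 𝔻 → V`, then `F⁻¹ = ψ⁻¹` on `V`. [folklore] -/
theorem TameShrink.symm_eq_of_eqOn {V : Set ℂ} (F : ℂ ≃ₜ ℂ) (ψ : ConformalEquiv (ball (0:ℂ) 1) V)
    (hF : EqOn F ψ (ball 0 1)) {w : ℂ} (hw : w ∈ V) : F.symm w = ψ.symm w :=
  F.injective (by rw [F.apply_symm_apply, hF (ψ.symm_mapsTo hw), ψ.apply_symm_apply hw])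

/-- The real dilation `w ↦ l w` (`0 < l`) maps the disc of radius `r` into the disc of radius `s` whenever
`l r ≤ s`. [folklore] -/
theorem TameShrink.mapsTo_mul_ball {l r s : ℝ} (hl : 0 < l) (h : l * r ≤ s) :
    MapsTo (fun w : ℂ => (l:ℂ) * w) (ball 0 r) (ball 0 s) := fun w hw => by
  rw [mem_ball_zero_iff] at hw ⊢
  rw [norm_mul, Complex.norm_of_nonneg hl.le]
  exact (mul_lt_mul_of_pos_left hw hl).trans_le h

/-- A shrink ratio `l ∈ (0, 1)` with `(1 - l) M < θ` exists (for `M, θ > 0`). [folklore] -/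
theorem TameShrink.exists_ratio {M θ : ℝ} (hM : 0 < M) (hθ : 0 < θ) :
    ∃ l : ℝ, 0 < l ∧ l < 1 ∧ (1 - l) * M < θ := by
  refine ⟨1 - min (1/2) (θ / (2 * M + 2)), ?_, ?_, ?_⟩
  · have : min (1/2 : ℝ) (θ / (2 * M + 2)) ≤ 1/2 := min_le_left _ _
    linarith
  · have : 0 < min (1/2 : ℝ) (θ / (2 * M + 2)) := lt_min one_half_pos (div_pos hθ (by linarith))
    linarith
  · rw [sub_sub_cancel]
    calc min (1/2 : ℝ) (θ / (2 * M + 2)) * M ≤ θ / (2 * M + 2) * M :=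
          mul_le_mul_of_nonneg_right (min_le_right _ _) hM.le
      _ < θ := by
          rw [div_mul_eq_mul_div, div_lt_iff₀ (by linarith)]
          nlinarith [mul_pos hθ hM]

/-- `stub_TameShrink` (registered stub 5 of the line `symmetric-seed-second-order`, PROVED): THE CONJUGATED SHRINK.
Let `(φ, x)` uniformize the conformal rectangle `R` and let the plane homeomorphism `F` extend the Riemann map
`φ ∘ cayley⁻¹ : 𝔻 → R`.  Then for every `η > 0` some plane homeomorphism `T` (namely `T_λ = F ∘ (λ ·) ∘ F⁻¹`,
`λ < 1` close to `1`) is `η`-close to the identity on the closed unit neighbourhood of `closure R` (uniform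
continuity of `F` on a closed disc containing `F⁻¹` of that compact set), `R.map T` is TAME (`G = F (λ ·)` is
holomorphic and injective on `|w| < 1/λ` and `(R.map T).carrier = T '' R.carrier = G '' 𝔻`), and `(T ∘ φ, x)`
uniformizes `R.map T` with the SAME real boundary preimages (`MarkedDomain.IsUniformizing.image_data`: on
`R.carrier = F 𝔻` the map `T = (φ ∘ cayley⁻¹) ∘ (λ ·) ∘ (φ ∘ cayley⁻¹)⁻¹` is holomorphic, injective and
continuous). [folklore] -/
theorem stub_TameShrink :
    ∀ (R : ConformalRectangle) (φ : ConformalEquiv UpperHalfPlane.upperHalfPlaneSet R.carrier) (x : Fin 4 → ℝ),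
      R.IsUniformizing φ x → ∀ F : ℂ ≃ₜ ℂ, Set.EqOn F (cayley.symm.trans φ) (Metric.ball 0 1) →
      ∀ η : ℝ, 0 < η → ∃ T : ℂ ≃ₜ ℂ,
        (∀ z ∈ Metric.cthickening 1 (closure R.carrier), dist (T z) z ≤ η) ∧
        (∃ G : ℂ → ℂ, ∃ r : ℝ, 1 < r ∧ DifferentiableOn ℂ G (Metric.ball 0 r) ∧ Set.InjOn G (Metric.ball 0 r) ∧
          (R.map T).carrier = G '' Metric.ball 0 1) ∧
        ∃ ψ : ConformalEquiv UpperHalfPlane.upperHalfPlaneSet (R.map T).carrier, (R.map T).IsUniformizing ψ x := by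
  intro R φ x hφx F hF η hη
  -- the Riemann map of the disc `φd = φ ∘ cayley⁻¹` and its plane extension `F`
  set φd : ConformalEquiv (ball (0:ℂ) 1) R.carrier := cayley.symm.trans φ with hφd
  have hball : F '' ball 0 1 = R.carrier := TameShrink.image_ball_of_eqOn F φd hF
  have hsymm : ∀ w ∈ R.carrier, F.symm w = φd.symm w := fun w hw =>
    TameShrink.symm_eq_of_eqOn F φd hF hw
  -- (i) a modulus `θ` of uniform continuity of `F` on a closed disc `|u| ≤ M` containing `F⁻¹ K`
  have hKc : IsCompact (cthickening 1 (closure R.carrier)) := R.isBounded.isCompact_closure.cthickening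
  obtain ⟨M, hM0, hM⟩ := (hKc.image F.symm.continuous).isBounded.exists_pos_norm_le
  obtain ⟨θ, hθ, hθF⟩ := Metric.uniformContinuousOn_iff.1
    ((isCompact_closedBall (0:ℂ) M).uniformContinuousOn_of_continuous F.continuous.continuousOn) η hη
  -- the shrink ratio and the conjugated shrink `T z = F (l F⁻¹ z)`
  obtain ⟨l, hl0, hl1, hlθ⟩ := TameShrink.exists_ratio hM0 hθ
  have hlc : ((l:ℝ):ℂ) ≠ 0 := Complex.ofReal_ne_zero.2 hl0.ne'
  obtain ⟨T, hT⟩ : ∃ T : ℂ ≃ₜ ℂ, ∀ z, T z = F ((l:ℂ) * F.symm z) :=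
    ⟨(F.symm.trans (Homeomorph.mulLeft₀ (l:ℂ) hlc)).trans F, fun _ => rfl⟩
  have hmul : ∀ s : Set ℂ, DifferentiableOn ℂ (fun w : ℂ => (l:ℂ) * w) s := fun s =>
    (differentiable_id.const_mul (l:ℂ)).differentiableOn
  refine ⟨T, fun z hz => ?_, ⟨fun w => F ((l:ℂ) * w), l⁻¹, (one_lt_inv₀ hl0).2 hl1, ?_, ?_, ?_⟩, ?_⟩
  · -- (i) `dist (T z) z ≤ η` on `K`
    have hzM : ‖F.symm z‖ ≤ M := hM _ (mem_image_of_mem _ hz)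
    have h3 : F.symm z ∈ closedBall (0:ℂ) M := mem_closedBall_zero_iff.2 hzM
    have h2 : (l:ℂ) * F.symm z ∈ closedBall (0:ℂ) M := by
      rw [mem_closedBall_zero_iff, norm_mul, Complex.norm_of_nonneg hl0.le]
      exact (mul_le_of_le_one_left (norm_nonneg _) hl1.le).trans hzM
    have h1 : dist ((l:ℂ) * F.symm z) (F.symm z) < θ := by
      rw [dist_comm, dist_eq_norm, ← one_sub_mul, norm_mul, ← Complex.ofReal_one, ← Complex.ofReal_sub,
        Complex.norm_of_nonneg (by linarith : (0:ℝ) ≤ 1 - l)]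
      exact (mul_le_mul_of_nonneg_left hzM (by linarith)).trans_lt hlθ
    have h4 := hθF _ h2 _ h3 h1
    rw [Homeomorph.apply_symm_apply] at h4
    rw [hT]
    exact h4.le
  · -- (ii) `G = F (l ·)` is holomorphic on `|w| < 1/l`
    have hmaps : MapsTo (fun w : ℂ => (l:ℂ) * w) (ball 0 l⁻¹) (ball 0 1) :=
      TameShrink.mapsTo_mul_ball hl0 (by rw [mul_inv_cancel₀ hl0.ne'])
    exact (φd.differentiableOn_coe.comp (hmul _) hmaps).congr fun w hw => hF (hmaps hw)
  · -- (ii) `G` is injective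
    exact fun a _ b _ hab => mul_left_cancel₀ hlc (F.injective hab)
  · -- (ii) `(R.map T).carrier = T '' F '' 𝔻 = G '' 𝔻`
    rw [MarkedDomain.carrier_map, ← hball, Set.image_image]
    exact Set.image_congr fun v _ => by rw [hT, Homeomorph.symm_apply_apply]
  · -- (iii) transport of the uniformizing datum along `T`, holomorphic on `R.carrier`
    have hmaps1 : MapsTo (fun w : ℂ => (l:ℂ) * w) (ball 0 1) (ball 0 1) :=
      TameShrink.mapsTo_mul_ball hl0 (by rw [mul_one]; exact hl1.le)
    have hd : DifferentiableOn ℂ T R.carrier := by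
      refine ((φd.differentiableOn_coe.comp (hmul _) hmaps1).comp φd.symm.differentiableOn_coe
        φd.symm_mapsTo).congr fun w hw => ?_
      rw [hT, hsymm w hw]
      exact hF (hmaps1 (φd.symm_mapsTo hw))
    exact ⟨_, hφx.image_data (S := R.map T) (h := T) hd T.injective.injOn T.continuous.continuousOn rfl
      fun _ => rfl⟩

end Summit.CriticalPhenomena.CardyFormulaZ2.Theorems.CornerLineDescent.SymmetricSeed
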